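import Summits.Parity.GeneralizedHardyLittlewood.Theorems.PrimeLevelFamEdgeMomentsBeyondDiagonalDiagLinePairsReindex
import Summits.Parity.GeneralizedHardyLittlewood.Theorems.PrimeLevelFamEdgeMomentsBeyondDiagonalDiagDecoratedReindex
import Literature.NumberTheory.LFunctions.KMVFirstMomentBeyondDiagonal
import HarnessLib

/-!
# Route `PrimeLevelFamEdge`, crux K_A `MomentsBeyondDiagonal` (stmt-Parity-20007), line «petersson_layers» v4, stub `stub_diag`:
# **the mollified Hecke-divisor double sum of the line series in decorated Selberg coordinates (census R3(ii), assembly brick)**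

The explicit line series of `…DiagShapeOfSeries.subDiag_of_lineSeries` is, at each order `(i,j)`, `(prefactor) ×
Σ_{m₁,m₂≤M} x_{m₁}x_{m₂} Σ_{d₁∣m₁}Σ_{d₂∣m₂} c·(m₁m₂)^{−1/2}·w(n₁, n₂, K)` with `x = KMV2000.mollifierCoeff P M`,
`c = gcd(m₁/d₁, m₂/d₂)`, `n₁ = d₁(m₂/d₂)/c`, `n₂ = d₂(m₁/d₁)/c`, `K = (m₁/c)(m₂/c)` and `w` the Bose double integral
(a function of the ordered factorisation `(n₁, n₂)` through the log-decorations, and of `K = n₁n₂`). For ANY such weight `w`: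

* `sum_mollifierCoeff_hecke_eq_decorated` — **`Σ_{m₁,m₂≤N} x_{m₁}x_{m₂} Σ_{d₁,d₂} c(m₁m₂)^{−1/2} w(n₁,n₂,K)
  = Σ_{c≤N}Σ_{g≤N/c} μ(g)·c·Σ_{k₁,k₂≤N/(cg)} (x′_{cgk₁}/(cgk₁))(x′_{cgk₂}/(cgk₂))·Σ_{d∣k₁}Σ_{e∣k₂} w(n₁,n₂,n₁n₂)`**,
  `n₁ = (k₁/d)(ge)`, `n₂ = (gd)(k₂/e)`, `x′_m = μ(m)ψ(m)⁻¹P(log(M/m)/log M) = m^{1/2}x_m`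
  (`sum_hecke_divisors_eq_sum_gcd_sum_factorisations'` + `quadForm_decorated_eq`).
This is the general-`Q` replacement for the `Q = 1` identity `…DiagSeriesAtOne.lineSeries_one_eq` + `quadForm_hKernel_eq`:
what remains for `stub_diag` (census R2 + the analytic half of R3(ii)) is the evaluation of the right-hand side for the
specific Bose weights `w = 𝔚_ij`.

Def-free; theorems only. Helper `--supports stmt-Parity-20007`; closes nothing; K_A, K_B and the Parity summit are NOT
proved; nothing about Landau–Siegel zeros.

## References
* E. Kowalski, P. Michel, J. VanderKam, J. reine angew. Math. 526 (2000), (21)–(23) pp. 12–13 and Prop. 5.1 p. 18.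
  [cite: KowalskiMichelVanderKam2000, (21)–(23) — derivation (diagonal of the mollified second moment, general Q)]
-/

noncomputable section

open Finset ArithmeticFunction Polynomial
open scoped ArithmeticFunction.Moebius

namespace Summit.Parity.GeneralizedHardyLittlewood.Theorems.MomentsBeyondDiagonal.DiagLines

open Literature.NumberTheory.LFunctions

/-- `m₁^{−1/2}·m₂^{−1/2}·(m₁m₂)^{−1/2} = (m₁m₂)⁻¹` for `m₁, m₂ ≥ 1`. [folklore] -/
theorem rpow_neg_half_mul_rpow_neg_half_mul {m₁ m₂ : ℕ} (h₁ : m₁ ≠ 0) (h₂ : m₂ ≠ 0) :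
    (m₁ : ℝ) ^ (-(1 / 2 : ℝ)) * (m₂ : ℝ) ^ (-(1 / 2 : ℝ)) * (((m₁ : ℝ) * m₂) ^ (-(1 / 2 : ℝ))) =
      ((m₁ : ℝ) * m₂)⁻¹ := by
  have hm₁ : (0 : ℝ) < m₁ := by exact_mod_cast Nat.pos_of_ne_zero h₁
  have hm₂ : (0 : ℝ) < m₂ := by exact_mod_cast Nat.pos_of_ne_zero h₂
  rw [← Real.mul_rpow hm₁.le hm₂.le, ← Real.rpow_add (mul_pos hm₁ hm₂),
    show (-(1 / 2 : ℝ)) + -(1 / 2 : ℝ) = -1 by norm_num, Real.rpow_neg_one]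

/-- **The mollified Hecke-divisor double sum in decorated Selberg coordinates.** For every real polynomial `P`, all
`M : ℝ`, `N : ℕ` and ANY weight `w(n₁, n₂, K)`, with `x = KMV2000.mollifierCoeff P M` and
`x′_m = μ(m)ψ(m)⁻¹P(log(M/m)/log M)`:
`Σ_{m₁,m₂≤N} x_{m₁}x_{m₂} Σ_{d₁∣m₁}Σ_{d₂∣m₂} gcd·(m₁m₂)^{−1/2}·w(d₁(m₂/d₂)/gcd, d₂(m₁/d₁)/gcd, (m₁/gcd)(m₂/gcd))
 = Σ_{c≤N}Σ_{g≤N/c} μ(g)·c·Σ_{k₁,k₂≤N/(cg)} (x′_{cgk₁}/(cgk₁))(x′_{cgk₂}/(cgk₂))·Σ_{d∣k₁}Σ_{e∣k₂} w(n₁, n₂, n₁n₂)`,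
`n₁ = (k₁/d)(ge)`, `n₂ = (gd)(k₂/e)`.
[cite: KowalskiMichelVanderKam2000, (21)–(23) — derivation (diagonal of the mollified second moment, general Q, Selberg-type coordinates)] -/
theorem sum_mollifierCoeff_hecke_eq_decorated (P : ℝ[X]) (M : ℝ) (N : ℕ) (w : ℕ → ℕ → ℕ → ℝ) :
    ∑ m₁ ∈ Icc 1 N, ∑ m₂ ∈ Icc 1 N,
        KMV2000.mollifierCoeff P M m₁ * KMV2000.mollifierCoeff P M m₂ *
          ∑ d₁ ∈ m₁.divisors, ∑ d₂ ∈ m₂.divisors,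
            ((m₁ / d₁).gcd (m₂ / d₂) : ℝ) * ((m₁ : ℝ) * m₂) ^ (-(1 / 2 : ℝ)) *
              w (d₁ * (m₂ / d₂ / (m₁ / d₁).gcd (m₂ / d₂))) (d₂ * (m₁ / d₁ / (m₁ / d₁).gcd (m₂ / d₂)))
                (m₁ / (m₁ / d₁).gcd (m₂ / d₂) * (m₂ / (m₁ / d₁).gcd (m₂ / d₂))) =
      ∑ c ∈ Icc 1 N, ∑ g ∈ Icc 1 (N / c), (μ g : ℝ) * c *
        ∑ k₁ ∈ Icc 1 (N / (c * g)), ∑ k₂ ∈ Icc 1 (N / (c * g)),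
          ((μ (c * g * k₁) : ℝ) * ((KMV2000.psi (c * g * k₁))⁻¹ *
              P.eval (Real.log (M / ((c * g * k₁ : ℕ) : ℝ)) / Real.log M)) / ((c * g * k₁ : ℕ) : ℝ)) *
            ((μ (c * g * k₂) : ℝ) * ((KMV2000.psi (c * g * k₂))⁻¹ *
              P.eval (Real.log (M / ((c * g * k₂ : ℕ) : ℝ)) / Real.log M)) / ((c * g * k₂ : ℕ) : ℝ)) *
            ∑ d ∈ k₁.divisors, ∑ e ∈ k₂.divisors,
              w (k₁ / d * (g * e)) (g * d * (k₂ / e)) (k₁ / d * (g * e) * (g * d * (k₂ / e))) := by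
  set x' : ℕ → ℝ := fun m ↦ (μ m : ℝ) * ((KMV2000.psi m)⁻¹ * P.eval (Real.log (M / m) / Real.log M)) with hx'
  -- Step 1: per pair `(m₁,m₂)`: Hecke divisors ↦ ordered factorisations, and `x x (m₁m₂)^{-1/2} = x′x′/(m₁m₂)`
  have hpair : ∀ m₁ ∈ Icc 1 N, ∀ m₂ ∈ Icc 1 N,
      KMV2000.mollifierCoeff P M m₁ * KMV2000.mollifierCoeff P M m₂ *
        ∑ d₁ ∈ m₁.divisors, ∑ d₂ ∈ m₂.divisors,
          ((m₁ / d₁).gcd (m₂ / d₂) : ℝ) * ((m₁ : ℝ) * m₂) ^ (-(1 / 2 : ℝ)) *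
            w (d₁ * (m₂ / d₂ / (m₁ / d₁).gcd (m₂ / d₂))) (d₂ * (m₁ / d₁ / (m₁ / d₁).gcd (m₂ / d₂)))
              (m₁ / (m₁ / d₁).gcd (m₂ / d₂) * (m₂ / (m₁ / d₁).gcd (m₂ / d₂))) =
      x' m₁ * x' m₂ *
        ((∑ c ∈ (Nat.gcd m₁ m₂).divisors, (c : ℝ) *
          ∑ D ∈ (m₁ / c * (m₂ / c)).divisors, w D (m₁ / c * (m₂ / c) / D) (D * (m₁ / c * (m₂ / c) / D))) /
          ((m₁ : ℝ) * m₂)) := by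
    intro m₁ hm₁ m₂ hm₂
    have h₁ : m₁ ≠ 0 := by have := (Finset.mem_Icc.1 hm₁).1; omega
    have h₂ : m₂ ≠ 0 := by have := (Finset.mem_Icc.1 hm₂).1; omega
    rw [sum_hecke_divisors_eq_sum_gcd_sum_factorisations' h₁ h₂
      (fun c n₁ n₂ K ↦ (c : ℝ) * ((m₁ : ℝ) * m₂) ^ (-(1 / 2 : ℝ)) * w n₁ n₂ K)]
    -- `K = D·(K/D)` in the last slot, and pull the constant `(m₁m₂)^{-1/2}` out
    have hin : ∑ c ∈ (Nat.gcd m₁ m₂).divisors, ∑ D ∈ (m₁ / c * (m₂ / c)).divisors,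
        (c : ℝ) * ((m₁ : ℝ) * m₂) ^ (-(1 / 2 : ℝ)) * w D (m₁ / c * (m₂ / c) / D) (m₁ / c * (m₂ / c)) =
        ((m₁ : ℝ) * m₂) ^ (-(1 / 2 : ℝ)) * ∑ c ∈ (Nat.gcd m₁ m₂).divisors, (c : ℝ) *
          ∑ D ∈ (m₁ / c * (m₂ / c)).divisors, w D (m₁ / c * (m₂ / c) / D) (D * (m₁ / c * (m₂ / c) / D)) := by
      rw [Finset.mul_sum]
      refine Finset.sum_congr rfl fun c _ ↦ ?_
      rw [Finset.mul_sum, Finset.mul_sum]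
      refine Finset.sum_congr rfl fun D hD ↦ ?_
      rw [Nat.mul_div_cancel' (Nat.mem_divisors.1 hD).1]
      ring
    rw [hin]
    set S : ℝ := ∑ c ∈ (Nat.gcd m₁ m₂).divisors, (c : ℝ) *
      ∑ D ∈ (m₁ / c * (m₂ / c)).divisors, w D (m₁ / c * (m₂ / c) / D) (D * (m₁ / c * (m₂ / c) / D)) with hS
    have hprod := rpow_neg_half_mul_rpow_neg_half_mul h₁ h₂
    unfold KMV2000.mollifierCoeff
    simp only [hx']
    rw [div_eq_mul_inv S ((m₁ : ℝ) * m₂), ← hprod]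
    ring
  rw [Finset.sum_congr rfl fun m₁ hm₁ ↦ Finset.sum_congr rfl fun m₂ hm₂ ↦ hpair m₁ hm₁ m₂ hm₂]
  -- Step 2: the decorated Selberg reindexing
  have key := quadForm_decorated_eq x' (fun D D' ↦ w D D' (D * D')) N
  simp only [hx'] at key ⊢
  rw [key]

end Summit.Parity.GeneralizedHardyLittlewood.Theorems.MomentsBeyondDiagonal.DiagLines

end
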